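import Summits.KontsevichZagierPeriods.KontsevichZagierPeriods.Theses.HermiteRigidity
import Literature.NumberTheory.Transcendental.EllIterRep
import Literature.NumberTheory.Transcendental.SemialgebraicMapsProofs
import Literature.NumberTheory.Transcendental.KZLogCalculusProofs

/-!
# `GenusTwoCycleTransfer` (stmt-KontsevichZagierPeriods-3408) — negative knowledge, part 1: the canonical witnesses

Support file for the crux `HermiteRigidity.GenusTwoCycleTransfer` (cdisprove seat, cycle 1; work
file `Cruxes/GenusTwoCycleTransfer/Disproof.lean`). On the genus-2 curve
`y² = f(x) = x(x−1)(x−2)(x−3)(x−5)` the crux quantifies over representations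
`r₁ r₂ r₃ : KZ.IntegralRep 1` with domains `(0,1), (2,3), (5,∞)` and integrand `1/√f` there. This
file shows that such representations EXIST (so the crux is not vacuous) and have POSITIVE values:
the three ovals are `ℚ`-semialgebraic, `1/√f = √(1/f)` is a `ℚ`-semialgebraic function where
`f > 0`, and `1/√f` is absolutely integrable on each oval — dominated by the model singularity
`(√(x−a))⁻¹ + (√(a+1−x))⁻¹` on the bounded ovals (from `(x−a)(a+1−x) ≤ f`), by `(√(x−5))⁻¹` on
`(5,6]` and by `15·x⁻²` on `[6,∞)` (from `x⁴/225 ≤ f`). Everything is read back on `ℝ` through the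
volume-preserving `MeasurableEquiv.funUnique (Fin 1) ℝ`. Part 2 (`LoadBearing`) uses these
witnesses. No definitions or notations are introduced (the quintic is written out).
[Kontsevich–Zagier 2001, §1.1] [folklore]
-/

noncomputable section

open Set MeasureTheory MvPolynomial
open Literature.NumberTheory.Transcendental Literature.ModelTheory.ExponentialFields

namespace Summit.KontsevichZagierPeriods.HermiteRigidity.GenusTwoCycleTransferNegative

/-! ### §1 Semialgebraicity of the data -/

/-- The oval `(2,3) ⊆ ℝ¹` is `ℚ`-semialgebraic. [folklore] -/
theorem isSemialgebraic_oval23 : IsSemialgebraic ℚ {p : Fin 1 → ℝ | 2 < p 0 ∧ p 0 < 3} := by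
  have h1 := Literature.ModelTheory.ExponentialFields.isSemialgebraic_setOf_eval_lt (k := ℚ)
    (R := ℝ) (2 : MvPolynomial (Fin 1) ℚ) (X 0 : MvPolynomial (Fin 1) ℚ)
  have h2 := Literature.ModelTheory.ExponentialFields.isSemialgebraic_setOf_eval_lt (k := ℚ)
    (R := ℝ) (X 0 : MvPolynomial (Fin 1) ℚ) (3 : MvPolynomial (Fin 1) ℚ)
  simp only [aeval_X, map_ofNat] at h1 h2
  exact h1.inter h2

/-- The oval `(5,∞) ⊆ ℝ¹` is `ℚ`-semialgebraic. [folklore] -/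
theorem isSemialgebraic_oval5 : IsSemialgebraic ℚ {p : Fin 1 → ℝ | 5 < p 0} := by
  have h1 := Literature.ModelTheory.ExponentialFields.isSemialgebraic_setOf_eval_lt (k := ℚ)
    (R := ℝ) (5 : MvPolynomial (Fin 1) ℚ) (X 0 : MvPolynomial (Fin 1) ℚ)
  simp only [aeval_X, map_ofNat] at h1
  exact h1

/-- `1/√f` is a `ℚ`-semialgebraic function on any `ℚ`-semialgebraic set where `f > 0` (it is
`√(1/f)`, the square root of a rational function; `IsSemialgebraicFunOn.sqrt_holds`).
[cite: BochnakCosteRoy1998, §2.2] -/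
theorem invSqrt_semialgebraic {σ : Set (Fin 1 → ℝ)} (hσ : IsSemialgebraic ℚ σ)
    (hf : ∀ p ∈ σ, 0 < (p 0 * (p 0 - 1) * (p 0 - 2) * (p 0 - 3) * (p 0 - 5))) :
    IsSemialgebraicFunOn ℚ σ (fun p => 1 / Real.sqrt (p 0 * (p 0 - 1) * (p 0 - 2) * (p 0 - 3) * (p 0 - 5))) := by
  have h1 := isSemialgebraicFunOn_aeval_div_aeval hσ (1 : MvPolynomial (Fin 1) ℚ)
    (X 0 * (X 0 - 1) * (X 0 - 2) * (X 0 - 3) * (X 0 - 5)) (fun p hp => by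
      simpa using (hf p hp).ne')
  have h2 : IsSemialgebraicFunOn ℚ σ (fun p => 1 / (p 0 * (p 0 - 1) * (p 0 - 2) * (p 0 - 3) * (p 0 - 5))) := h1.congr (fun p _ => by simp)
  have h3 := IsSemialgebraicFunOn.sqrt_holds h2
  refine h3.congr (fun p _ => ?_)
  simp only [one_div, Real.sqrt_inv]

/-! ### §2 Absolute integrability on the three ovals -/

/-- `1/√f` is Borel measurable on `ℝ`. [folklore] -/
theorem measurable_invSqrt : Measurable (fun x : ℝ => 1 / Real.sqrt (x * (x - 1) * (x - 2) * (x - 3) * (x - 5))) := by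
  fun_prop

/-- For `0 < s < 1`: `(√s √(1-s))⁻¹ ≤ (√s)⁻¹ + (√(1-s))⁻¹` (square `1 ≤ √s + √(1−s)`). [folklore] -/
theorem inv_sqrt_mul_sqrt_le {s : ℝ} (hs : s ∈ Ioo (0 : ℝ) 1) :
    (Real.sqrt s * Real.sqrt (1 - s))⁻¹ ≤ (Real.sqrt s)⁻¹ + (Real.sqrt (1 - s))⁻¹ := by
  have h0 : 0 < Real.sqrt s := Real.sqrt_pos.mpr hs.1
  have h1 : 0 < Real.sqrt (1 - s) := Real.sqrt_pos.mpr (by linarith [hs.2])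
  have hs0 : Real.sqrt s ^ 2 = s := Real.sq_sqrt hs.1.le
  have hs1 : Real.sqrt (1 - s) ^ 2 = 1 - s := Real.sq_sqrt (by linarith [hs.2])
  have key : 1 ≤ Real.sqrt s + Real.sqrt (1 - s) := by nlinarith [mul_pos h0 h1]
  rw [inv_le_iff_one_le_mul₀ (mul_pos h0 h1)]
  calc (1 : ℝ) ≤ Real.sqrt s + Real.sqrt (1 - s) := key
    _ = ((Real.sqrt s)⁻¹ + (Real.sqrt (1 - s))⁻¹) * (Real.sqrt s * Real.sqrt (1 - s)) := by
        field_simp; ring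

/-- Model singularity: `(√(x−a))⁻¹ + (√(b−x))⁻¹` is integrable on `(a,b)` (tree:
`KZ.integrableOn_inv_sqrt_sub_left/right`). [folklore] -/
theorem integrableOn_model (a b : ℝ) :
    IntegrableOn (fun x : ℝ => (Real.sqrt (x - a))⁻¹ + (Real.sqrt (b - x))⁻¹) (Ioo a b) :=
  (KZ.integrableOn_inv_sqrt_sub_left a b).add (KZ.integrableOn_inv_sqrt_sub_right a b)

/-- Pointwise domination on a unit-length oval `(a, a+1)` from `(x−a)(a+1−x) ≤ F`. [folklore] -/
theorem inv_sqrt_le_model {x a : ℝ} (hx : x ∈ Ioo a (a + 1)) {F : ℝ} (hF : (x - a) * (a + 1 - x) ≤ F) :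
    1 / Real.sqrt F ≤ (Real.sqrt (x - a))⁻¹ + (Real.sqrt (a + 1 - x))⁻¹ := by
  have hs : x - a ∈ Ioo (0:ℝ) 1 := ⟨by linarith [hx.1], by linarith [hx.2]⟩
  have hpos : 0 < (x - a) * (a + 1 - x) := mul_pos hs.1 (by linarith [hx.2])
  have h1 : 1 / Real.sqrt F ≤ 1 / Real.sqrt ((x - a) * (a + 1 - x)) :=
    one_div_le_one_div_of_le (Real.sqrt_pos.mpr hpos) (Real.sqrt_le_sqrt hF)
  refine h1.trans ?_
  rw [Real.sqrt_mul hs.1.le, one_div]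
  have := inv_sqrt_mul_sqrt_le hs
  have e : 1 - (x - a) = a + 1 - x := by ring
  rw [e] at this
  exact this

/-- On `(0,1)`: `x(1−x) ≤ f(x)` (the cofactor `(2−x)(3−x)(5−x)` is `≥ 1`). [folklore] -/
theorem quintic_ge_01 {x : ℝ} (hx : x ∈ Ioo (0:ℝ) 1) : (x - 0) * (0 + 1 - x) ≤ (x * (x - 1) * (x - 2) * (x - 3) * (x - 5)) := by
  have hg : (1:ℝ) ≤ (2 - x) * (3 - x) * (5 - x) :=
    one_le_mul_of_one_le_of_one_le (one_le_mul_of_one_le_of_one_le (by linarith [hx.2])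
      (by linarith [hx.2])) (by linarith [hx.2])
  have h0 : 0 ≤ x * (1 - x) := mul_nonneg hx.1.le (by linarith [hx.2])
  have : (x * (x - 1) * (x - 2) * (x - 3) * (x - 5)) = x * (1 - x) * ((2 - x) * (3 - x) * (5 - x)) := by ring
  rw [this]
  calc (x - 0) * (0 + 1 - x) = x * (1 - x) * 1 := by ring
    _ ≤ x * (1 - x) * ((2 - x) * (3 - x) * (5 - x)) := mul_le_mul_of_nonneg_left hg h0

/-- On `(2,3)`: `(x−2)(3−x) ≤ f(x)` (the cofactor `x(x−1)(5−x)` is `≥ 1`). [folklore] -/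
theorem quintic_ge_23 {x : ℝ} (hx : x ∈ Ioo (2:ℝ) 3) : (x - 2) * (2 + 1 - x) ≤ (x * (x - 1) * (x - 2) * (x - 3) * (x - 5)) := by
  have hg : (1:ℝ) ≤ x * (x - 1) * (5 - x) :=
    one_le_mul_of_one_le_of_one_le (one_le_mul_of_one_le_of_one_le (by linarith [hx.1])
      (by linarith [hx.1])) (by linarith [hx.2])
  have h0 : 0 ≤ (x - 2) * (3 - x) := mul_nonneg (by linarith [hx.1]) (by linarith [hx.2])
  have : (x * (x - 1) * (x - 2) * (x - 3) * (x - 5)) = (x - 2) * (3 - x) * (x * (x - 1) * (5 - x)) := by ring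
  rw [this]
  calc (x - 2) * (2 + 1 - x) = (x - 2) * (3 - x) * 1 := by ring
    _ ≤ (x - 2) * (3 - x) * (x * (x - 1) * (5 - x)) := mul_le_mul_of_nonneg_left hg h0

/-- `f > 0` on the oval `(0,1)`. [folklore] -/
theorem quintic_pos_01 {x : ℝ} (hx : x ∈ Ioo (0:ℝ) 1) : 0 < (x * (x - 1) * (x - 2) * (x - 3) * (x - 5)) :=
  lt_of_lt_of_le (by nlinarith [hx.1, hx.2]) (quintic_ge_01 hx)

/-- `f > 0` on the oval `(2,3)`. [folklore] -/
theorem quintic_pos_23 {x : ℝ} (hx : x ∈ Ioo (2:ℝ) 3) : 0 < (x * (x - 1) * (x - 2) * (x - 3) * (x - 5)) :=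
  lt_of_lt_of_le (by nlinarith [hx.1, hx.2]) (quintic_ge_23 hx)

/-- `f > 0` on the oval `(5,∞)`. [folklore] -/
theorem quintic_pos_5 {x : ℝ} (hx : x ∈ Ioi (5:ℝ)) : 0 < (x * (x - 1) * (x - 2) * (x - 3) * (x - 5)) := by
  have hx' : 5 < x := hx
  have h1 : 0 < x * (x - 1) * (x - 2) * (x - 3) :=
    mul_pos (mul_pos (mul_pos (by linarith) (by linarith)) (by linarith)) (by linarith)
  exact mul_pos h1 (by linarith)

/-- `1/√f` is integrable on `(0,1)`. [folklore] -/
theorem integrableOn_Ioo01 : IntegrableOn (fun x : ℝ => 1 / Real.sqrt (x * (x - 1) * (x - 2) * (x - 3) * (x - 5))) (Ioo 0 1) := by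
  refine Integrable.mono' (integrableOn_model 0 (0 + 1) |>.mono_set (by norm_num))
    measurable_invSqrt.aestronglyMeasurable ?_
  filter_upwards [ae_restrict_mem measurableSet_Ioo] with x hx
  rw [Real.norm_of_nonneg (by positivity)]
  exact inv_sqrt_le_model (a := 0) (by simpa using hx) (quintic_ge_01 hx)

/-- `1/√f` is integrable on `(2,3)`. [folklore] -/
theorem integrableOn_Ioo23 : IntegrableOn (fun x : ℝ => 1 / Real.sqrt (x * (x - 1) * (x - 2) * (x - 3) * (x - 5))) (Ioo 2 3) := by
  refine Integrable.mono' (integrableOn_model 2 (2 + 1) |>.mono_set (by norm_num))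
    measurable_invSqrt.aestronglyMeasurable ?_
  filter_upwards [ae_restrict_mem measurableSet_Ioo] with x hx
  rw [Real.norm_of_nonneg (by positivity)]
  exact inv_sqrt_le_model (a := 2) (by norm_num at hx ⊢; exact hx) (quintic_ge_23 hx)

/-- Near the branch point `5`: on `(5,6]`, `x − 5 ≤ f(x)`, so `1/√f ≤ (√(x−5))⁻¹`. [folklore] -/
theorem integrableOn_Ioc56 : IntegrableOn (fun x : ℝ => 1 / Real.sqrt (x * (x - 1) * (x - 2) * (x - 3) * (x - 5))) (Ioc 5 6) := by
  rw [integrableOn_Ioc_iff_integrableOn_Ioo]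
  refine Integrable.mono' (KZ.integrableOn_inv_sqrt_sub_left 5 6)
    measurable_invSqrt.aestronglyMeasurable ?_
  filter_upwards [ae_restrict_mem measurableSet_Ioo] with x hx
  rw [Real.norm_of_nonneg (by positivity)]
  have hx5 : 0 < x - 5 := by linarith [hx.1]
  have hg : (1:ℝ) ≤ x * (x - 1) * (x - 2) * (x - 3) :=
    one_le_mul_of_one_le_of_one_le (one_le_mul_of_one_le_of_one_le
      (one_le_mul_of_one_le_of_one_le (by linarith [hx.1]) (by linarith [hx.1]))
      (by linarith [hx.1])) (by linarith [hx.1])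
  have hF : x - 5 ≤ (x * (x - 1) * (x - 2) * (x - 3) * (x - 5)) := by
    have : (x * (x - 1) * (x - 2) * (x - 3) * (x - 5)) = (x - 5) * (x * (x - 1) * (x - 2) * (x - 3)) := by ring
    rw [this]
    calc x - 5 = (x - 5) * 1 := by ring
      _ ≤ (x - 5) * (x * (x - 1) * (x - 2) * (x - 3)) := mul_le_mul_of_nonneg_left hg hx5.le
  rw [one_div]
  exact inv_anti₀ (Real.sqrt_pos.mpr hx5) (Real.sqrt_le_sqrt hF)

/-- The tail: on `[6,∞)`, `x⁴/225 ≤ f(x)`, so `1/√f ≤ 15 · x^{-2}`, integrable. [folklore] -/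
theorem integrableOn_Ioi6 : IntegrableOn (fun x : ℝ => 1 / Real.sqrt (x * (x - 1) * (x - 2) * (x - 3) * (x - 5))) (Ioi 6) := by
  have htail : IntegrableOn (fun x : ℝ => 15 * x ^ (-2 : ℝ)) (Ioi 6) :=
    (integrableOn_Ioi_rpow_of_lt (by norm_num) (by norm_num)).const_mul 15
  refine Integrable.mono' htail measurable_invSqrt.aestronglyMeasurable ?_
  filter_upwards [ae_restrict_mem measurableSet_Ioi] with x hx
  have hx6 : 6 < x := hx
  have hx0 : 0 < x := by linarith
  rw [Real.norm_of_nonneg (by positivity)]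
  have hF : (x ^ 2 / 15) ^ 2 ≤ (x * (x - 1) * (x - 2) * (x - 3) * (x - 5)) := by
    nlinarith [mul_pos hx0 hx0, sq_nonneg (x - 6), mul_pos (mul_pos hx0 hx0) (mul_pos hx0 hx0),
      mul_pos (mul_pos hx0 hx0) hx0]
  have hsq : Real.sqrt ((x ^ 2 / 15) ^ 2) = x ^ 2 / 15 := Real.sqrt_sq (by positivity)
  have h1 : 1 / Real.sqrt (x * (x - 1) * (x - 2) * (x - 3) * (x - 5)) ≤ 1 / (x ^ 2 / 15) := by
    rw [← hsq]
    exact one_div_le_one_div_of_le (by rw [hsq]; positivity) (Real.sqrt_le_sqrt hF)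
  refine h1.trans (le_of_eq ?_)
  rw [Real.rpow_neg hx0.le, Real.rpow_two]
  field_simp

/-- `1/√f` is integrable on `(5,∞)`. [folklore] -/
theorem integrableOn_Ioi5 : IntegrableOn (fun x : ℝ => 1 / Real.sqrt (x * (x - 1) * (x - 2) * (x - 3) * (x - 5))) (Ioi 5) := by
  have : Ioi (5:ℝ) = Ioc 5 6 ∪ Ioi 6 := (Ioc_union_Ioi_eq_Ioi (by norm_num)).symm
  rw [this]
  exact integrableOn_Ioc56.union integrableOn_Ioi6

/-! ### §3 Reading `ℝ¹` on `ℝ`, positivity, and the witnesses -/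

/-- Transfer of integrability from `ℝ` to `ℝ¹`. [folklore] -/
theorem integrableOn_fin_one {g : ℝ → ℝ} {S : Set ℝ} (h : IntegrableOn g S) :
    IntegrableOn (fun p : Fin 1 → ℝ => g (p 0)) {p | p 0 ∈ S} := by
  have hmp := MeasureTheory.volume_preserving_funUnique (Fin 1) ℝ
  have hpre : {p : Fin 1 → ℝ | p 0 ∈ S} = MeasurableEquiv.funUnique (Fin 1) ℝ ⁻¹' S := by
    ext x
    simp [MeasurableEquiv.funUnique, Fin.default_eq_zero]
  rw [hpre]
  exact (hmp.integrableOn_comp_preimage (MeasurableEquiv.measurableEmbedding _)).mpr h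

/-- Transfer of set integrals from `ℝ¹` to `ℝ`. [folklore] -/
theorem setIntegral_fin_one (g : ℝ → ℝ) (S : Set ℝ) :
    ∫ p in {p : Fin 1 → ℝ | p 0 ∈ S}, g (p 0) = ∫ x in S, g x := by
  have hmp := MeasureTheory.volume_preserving_funUnique (Fin 1) ℝ
  have hpre : {p : Fin 1 → ℝ | p 0 ∈ S} = MeasurableEquiv.funUnique (Fin 1) ℝ ⁻¹' S := by
    ext x
    simp [MeasurableEquiv.funUnique, Fin.default_eq_zero]
  have h1 := hmp.setIntegral_preimage_emb (MeasurableEquiv.measurableEmbedding _) g S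
  rw [hpre, ← h1]
  rfl

/-- Positivity of `∫_S dx/√f` over a set of positive measure inside `{f > 0}` on which `1/√f` is
integrable. [folklore] -/
theorem setIntegral_invSqrt_pos {S : Set ℝ} (hvol : 0 < volume S) (hpos : ∀ x ∈ S, 0 < (x * (x - 1) * (x - 2) * (x - 3) * (x - 5)))
    (hint : IntegrableOn (fun x : ℝ => 1 / Real.sqrt (x * (x - 1) * (x - 2) * (x - 3) * (x - 5))) S) :
    0 < ∫ x in S, 1 / Real.sqrt (x * (x - 1) * (x - 2) * (x - 3) * (x - 5)) := by
  rw [setIntegral_pos_iff_support_of_nonneg_ae (Filter.Eventually.of_forall fun x => by positivity)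
    hint]
  have : Function.support (fun x : ℝ => 1 / Real.sqrt (x * (x - 1) * (x - 2) * (x - 3) * (x - 5))) ∩ S = S := by
    refine inter_eq_right.mpr fun x hx => ?_
    rw [Function.mem_support]
    exact (one_div_pos.mpr (Real.sqrt_pos.mpr (hpos x hx))).ne'
  rwa [this]

/-- The value of a representation with domain `{p | p 0 ∈ S}` whose integrand is `1/√f` ON the
domain is `∫_S dx/√f`. [folklore] -/
theorem value_eq_setIntegral {S : Set ℝ} {r : KZ.IntegralRep 1} (hd : r.domain = {p | p 0 ∈ S})
    (hi : EqOn r.integrand (fun p => 1 / Real.sqrt (p 0 * (p 0 - 1) * (p 0 - 2) * (p 0 - 3) * (p 0 - 5))) {p | p 0 ∈ S}) :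
    r.value = ∫ x in S, 1 / Real.sqrt (x * (x - 1) * (x - 2) * (x - 3) * (x - 5)) := by
  rw [KZ.IntegralRep.value, hd, ← setIntegral_fin_one (fun x => 1 / Real.sqrt (x * (x - 1) * (x - 2) * (x - 3) * (x - 5))) S]
  refine setIntegral_congr_fun ?_ hi
  rw [← hd]
  exact KZ.IntegralRep.measurableSet_domain_holds r

/-- Builder: a representation `[{p | p 0 ∈ S}, 1/√f]` exists as soon as the domain is
`ℚ`-semialgebraic, `f > 0` on it and `1/√f` is integrable on `S`; its value is `∫_S dx/√f`.
[cite: KontsevichZagier2001, §1.1] -/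
theorem exists_rep {S : Set ℝ} (hσ : IsSemialgebraic ℚ {p : Fin 1 → ℝ | p 0 ∈ S})
    (hpos : ∀ x ∈ S, 0 < (x * (x - 1) * (x - 2) * (x - 3) * (x - 5))) (hint : IntegrableOn (fun x : ℝ => 1 / Real.sqrt (x * (x - 1) * (x - 2) * (x - 3) * (x - 5))) S) :
    ∃ r : KZ.IntegralRep 1, r.domain = {p | p 0 ∈ S} ∧
      r.integrand = (fun p => 1 / Real.sqrt (p 0 * (p 0 - 1) * (p 0 - 2) * (p 0 - 3) * (p 0 - 5))) ∧ r.value = ∫ x in S, 1 / Real.sqrt (x * (x - 1) * (x - 2) * (x - 3) * (x - 5)) :=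
  ⟨⟨{p | p 0 ∈ S}, fun p => 1 / Real.sqrt (p 0 * (p 0 - 1) * (p 0 - 2) * (p 0 - 3) * (p 0 - 5)), hσ, invSqrt_semialgebraic hσ fun _ hp => hpos _ hp,
    integrableOn_fin_one hint⟩, rfl, rfl, setIntegral_fin_one (fun x => 1 / Real.sqrt (x * (x - 1) * (x - 2) * (x - 3) * (x - 5))) S⟩

/-- **Witness on the first oval**: `[(0,1), 1/√f]` exists and `I₁ = ∫₀¹ dx/√f > 0` is its value.
[cite: KontsevichZagier2001, §1.1] -/
theorem exists_rep01 : ∃ r : KZ.IntegralRep 1, r.domain = {p | 0 < p 0 ∧ p 0 < 1} ∧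
    r.integrand = (fun p => 1 / Real.sqrt (p 0 * (p 0 - 1) * (p 0 - 2) * (p 0 - 3) * (p 0 - 5))) ∧
    r.value = ∫ x in Ioo (0:ℝ) 1, 1 / Real.sqrt (x * (x - 1) * (x - 2) * (x - 3) * (x - 5)) ∧ 0 < r.value := by
  obtain ⟨r, hd, hi, hv⟩ := exists_rep (S := Ioo 0 1) isSemialgebraic_unitInterval_fin_one
    (fun x hx => quintic_pos_01 hx) integrableOn_Ioo01
  exact ⟨r, hd, hi, hv, hv ▸ setIntegral_invSqrt_pos (by simp) (fun x hx => quintic_pos_01 hx)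
    integrableOn_Ioo01⟩

/-- **Witness on the second oval**: `[(2,3), 1/√f]` exists and `I₂ = ∫₂³ dx/√f > 0` is its value.
[cite: KontsevichZagier2001, §1.1] -/
theorem exists_rep23 : ∃ r : KZ.IntegralRep 1, r.domain = {p | 2 < p 0 ∧ p 0 < 3} ∧
    r.integrand = (fun p => 1 / Real.sqrt (p 0 * (p 0 - 1) * (p 0 - 2) * (p 0 - 3) * (p 0 - 5))) ∧
    r.value = ∫ x in Ioo (2:ℝ) 3, 1 / Real.sqrt (x * (x - 1) * (x - 2) * (x - 3) * (x - 5)) ∧ 0 < r.value := by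
  obtain ⟨r, hd, hi, hv⟩ := exists_rep (S := Ioo 2 3) isSemialgebraic_oval23
    (fun x hx => quintic_pos_23 hx) integrableOn_Ioo23
  exact ⟨r, hd, hi, hv, hv ▸ setIntegral_invSqrt_pos (by simp; norm_num)
    (fun x hx => quintic_pos_23 hx) integrableOn_Ioo23⟩

/-- **Witness on the unbounded oval**: `[(5,∞), 1/√f]` exists and `I₃ = ∫₅^∞ dx/√f > 0` is its
value. [cite: KontsevichZagier2001, §1.1] -/
theorem exists_rep5 : ∃ r : KZ.IntegralRep 1, r.domain = {p | 5 < p 0} ∧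
    r.integrand = (fun p => 1 / Real.sqrt (p 0 * (p 0 - 1) * (p 0 - 2) * (p 0 - 3) * (p 0 - 5))) ∧
    r.value = ∫ x in Ioi (5:ℝ), 1 / Real.sqrt (x * (x - 1) * (x - 2) * (x - 3) * (x - 5)) ∧ 0 < r.value := by
  obtain ⟨r, hd, hi, hv⟩ := exists_rep (S := Ioi 5) isSemialgebraic_oval5
    (fun x hx => quintic_pos_5 hx) integrableOn_Ioi5
  exact ⟨r, hd, hi, hv, hv ▸ setIntegral_invSqrt_pos (by simp) (fun x hx => quintic_pos_5 hx)
    integrableOn_Ioi5⟩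

/-- The representation with EMPTY domain and integrand `1/√f` (value `0`): it satisfies every
integrand hypothesis of the crux and none of the domain hypotheses. [folklore] -/
theorem exists_emptyRep : ∃ r : KZ.IntegralRep 1, r.domain = ∅ ∧
    r.integrand = (fun p => 1 / Real.sqrt (p 0 * (p 0 - 1) * (p 0 - 2) * (p 0 - 3) * (p 0 - 5))) ∧ r.value = 0 :=
  ⟨⟨∅, fun p => 1 / Real.sqrt (p 0 * (p 0 - 1) * (p 0 - 2) * (p 0 - 3) * (p 0 - 5)), isSemialgebraic_empty,
    (isSemialgebraicFunOn_aeval isSemialgebraic_empty 0).congr fun _ hx => hx.elim, integrableOn_empty⟩,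
    rfl, rfl, by simp [KZ.IntegralRep.value]⟩

/-- The zero-integrand representation on a `ℚ`-semialgebraic set (value `0`; tree:
`KZ.exists_zeroRep`). [folklore] -/
theorem exists_zeroRep {σ : Set (Fin 1 → ℝ)} (hσ : IsSemialgebraic ℚ σ) :
    ∃ z : KZ.IntegralRep 1, z.domain = σ ∧ z.integrand = 0 ∧ z.value = 0 := by
  obtain ⟨z, hd, hi⟩ := KZ.exists_zeroRep hσ
  exact ⟨z, hd, hi, by simp [KZ.IntegralRep.value, hi]⟩

end Summit.KontsevichZagierPeriods.HermiteRigidity.GenusTwoCycleTransferNegative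

end
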